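import Literature.AlgebraicGeometry.Motives.CechH1ToSheafCohomologySurjective
import Literature.AlgebraicGeometry.Motives.CechH1OfSheafCohomology
import Literature.AlgebraicGeometry.Morphisms.CechH1LengthComparison
import HarnessLib

/-!
# `Ȟ¹(𝔘, 𝒪_X) ≅ H¹(X, 𝒪_X)` for one AFFINE open cover, in the tree's two degree-one currencies, WITH SCALARS
# (Hartshorne III Lemma 4.4, Ex. 4.4, Thm. 4.5; Görtz–Wedhorn II Cor. 21.81 / Thm. 22.9 in degree one)

Layer `Literature/AlgebraicGeometry/Motives`, namespace `Literature.AlgebraicGeometry.Motives`.  THEOREMS ONLY (no definition, no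
named fact, no instance, no notation, no `sorry`).  Cell `hodgecm-mathlib` (D-0151), (Mc) grandchild line N3′, brick **S-c2** (J3 of the
(Mc) JOIN BRIEF; author B-p08 (g15); consumer S-e of B-p07 (g20) through S-c1 of B-p03 (g20)): the DICTIONARY between the structure-sheaf
Čech group `Morphisms.CechH1 f 𝔘` of an `A`-scheme `f : X → Spec A` (the `A`-module in which (H1′) computes `dim_κ Ȟ¹(A′_κ, 𝒪) = g`) and
Mathlib's sheaf cohomology `Motives.structureSheafCohomology X 1 = H¹(X, 𝒪_X)` (the currency of ★ Hartshorne DT Thm. 6.4 /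
`Modules/PicardGroup*`), for ONE affine open cover, TOGETHER WITH SCALARS: endomorphisms of the abelian structure sheaf that act
sectionwise as multiplication by `a ∈ A` act on `H¹` as `a •` acts on `Ȟ¹`.

Everything is an ASSEMBLY of ★ bricks: the natural injective comparison ★ `Motives.cechHOneToH` ([Hartshorne1977] III Lemma 4.4,
`Motives/CechH1ToSheafCohomology`: injective for every cover, natural in the sheaf, compatible with refinement), the surjectivity in the
limit ★ `Motives.exists_cechHOneToH_eq` + `cechHOneToH_eq_cechHOneToH_iff` ([Hartshorne1977] III Ex. 4.4 (c),
`Motives/CechH1ToSheafCohomologySurjective`), and the bijectivity of refinement from an AFFINE cover ★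
`Morphisms.cechRefineH1_bijective_of_isAffineOpen` ([Hartshorne1977] III Thm. 4.5 in degree one, `Morphisms/CechH1LengthComparison`).

* §1 `exists_addEquiv_cechHOne_cechH1` — the two Čech MODELS agree: the ordered-pair Čech group `Motives.CechHOne (structureSheafAb X) 𝔘` of
  the abelian structure sheaf (★ `CechH1ToSheafCohomology`) IS `Morphisms.CechH1 f 𝔘` (same cochains and differentials, definitionally —
  ★ `structureSheafAb_obj`, ★ `sheafSecRes_structureSheafAb`; only the quotient packaging differs), with the three compatibilities (classes,
  refinement, sectionwise-scalar endomorphisms).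
* §2 **`exists_cechH1_to_structureSheafCohomology`** — for EVERY open cover: an INJECTIVE additive `Φ : Ȟ¹(𝔘, 𝒪_X) → H¹(X, 𝒪_X)` with
  `Φ [z] = cechToH z` and the SCALAR CLAUSE `Φ (a • t) = H¹(μ) (Φ t)` for every endomorphism `μ` of the abelian structure sheaf with
  `μ_V(x) = a|_V · x`.
* §3 **`exists_addEquiv_structureSheafCohomology_cechH1`** — for an AFFINE open cover (no separatedness, any index type in `Type u`):
  `Φ` is onto, whence **`e : H¹(X, 𝒪_X) ≃+ Ȟ¹(𝔘, 𝒪_X)` with `e (H¹(μ) t) = a • e t`** — the letter S-e consumes (at `X = A′_κ`, `a = c̄`).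
* §4 `exists_structureSheafAb_hom_mul` / `exists_structureSheafAb_hom_algebraMap` — the scalar endomorphisms `μ` of §2–§3 EXIST
  (multiplication by a global function on the abelian structure sheaf, built with `ObjectProperty.homMk`).

HC_CM is proved only modulo the 7 printed citations until rung 0 closes; nothing here is about HC.

## References
* [Hartshorne1977] R. Hartshorne, *Algebraic Geometry* (1977), III Lemma 4.4 (p. 221), Ex. 4.4 (a)–(c), Thm. 4.5.
* [GortzWedhorn2023] U. Görtz, T. Wedhorn, *Algebraic Geometry II* (2023), Cor. 21.81 (p. 185), Thm. 22.9.
* [StacksProject] The Stacks Project, Tags 01ED, 01XD (Čech cohomology of quasi-coherent modules on affine covers).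
-/

set_option autoImplicit false

noncomputable section

universe u

open CategoryTheory CategoryTheory.Limits AlgebraicGeometry TopologicalSpace Opposite

namespace Literature.AlgebraicGeometry.Motives

open Literature.AlgebraicGeometry.Morphisms

variable {A : Type u} [CommRing A] {X : Scheme.{u}} (f : X ⟶ Spec (.of A)) {ι : Type u} (U : ι → X.Opens)

/-! ## §1 The two Čech models of `Ȟ¹(𝔘, 𝒪_X)` agree -/

/-- Cocycles agree: a `1`-cochain of `𝒪_X` on `𝔘` is a cocycle of the abelian structure sheaf (★ `Motives.cechOneCocycles`) iff it is one in
`Morphisms/CechH1` (★ `Morphisms.cechZ1`) — same differential, definitionally. [cite: Hartshorne1977, III §4 Definition (p. 218)] -/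
theorem mem_cechOneCocycles_structureSheafAb_iff (c : CechC1 f U) :
    (show CechOneCochain (structureSheafAb X) U from c) ∈ cechOneCocycles (structureSheafAb X) U ↔ c ∈ cechZ1 f U := by
  rw [mem_cechOneCocycles_iff, mem_cechZ1_iff]
  constructor
  · intro h
    funext i j k
    exact h i j k
  · intro h i j k
    exact congrFun (congrFun (congrFun h i) j) k

/-- Coboundaries agree (same `d⁰`, definitionally). [cite: Hartshorne1977, III §4 Definition (p. 218)] -/
theorem mem_cechOneCoboundaries_structureSheafAb_iff (c : CechC1 f U) :
    (show CechOneCochain (structureSheafAb X) U from c) ∈ cechOneCoboundaries (structureSheafAb X) U ↔ c ∈ cechB1 f U := by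
  rw [mem_cechOneCoboundaries_iff, mem_cechB1_iff]
  constructor
  · rintro ⟨b, hb⟩
    exact ⟨b, funext fun i => funext fun j => (hb i j).symm⟩
  · rintro ⟨b, hb⟩
    exact ⟨b, fun i j => (congrFun (congrFun hb i) j).symm⟩

/-- **The two models of `Ȟ¹(𝔘, 𝒪_X)` are canonically isomorphic**: there is an additive isomorphism
`Motives.CechHOne (𝒪_X)_{Ab} 𝔘 ≃+ Morphisms.CechH1 f 𝔘` sending the class of a cocycle to the class of the SAME cocycle.
[cite: Hartshorne1977, III §4 Definition (p. 218)] [cite: StacksProject, Tag 01ED] -/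
theorem exists_addEquiv_cechHOne_cechH1 :
    ∃ e : CechHOne (structureSheafAb X) U ≃+ CechH1 f U,
      ∀ z : cechOneCocycles (structureSheafAb X) U,
        e (CechHOne.mk (structureSheafAb X) U z) =
          CechH1.mk f U ⟨(z : CechOneCochain (structureSheafAb X) U),
            (mem_cechOneCocycles_structureSheafAb_iff f U _).mp z.2⟩ := by
  -- the map on cocycles and its descent to classes
  let g : ↥(cechOneCocycles (structureSheafAb X) U) →+ CechH1 f U :=
    AddMonoidHom.mk'
      (fun z => CechH1.mk f U ⟨(z : CechOneCochain (structureSheafAb X) U),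
        (mem_cechOneCocycles_structureSheafAb_iff f U _).mp z.2⟩)
      (fun z z' => by
        rw [← map_add]
        rfl)
  have hg : ∀ z ∈ (cechOneCoboundaries (structureSheafAb X) U).addSubgroupOf (cechOneCocycles (structureSheafAb X) U),
      g z = 0 := fun z hz => by
    change CechH1.mk f U _ = 0
    rw [CechH1.mk_eq_zero_iff]
    exact (mem_cechOneCoboundaries_structureSheafAb_iff f U _).mp ((AddSubgroup.mem_addSubgroupOf).mp hz)
  let φ : CechHOne (structureSheafAb X) U →+ CechH1 f U := QuotientAddGroup.lift _ g hg
  have hφ : ∀ z : cechOneCocycles (structureSheafAb X) U,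
      φ (CechHOne.mk (structureSheafAb X) U z) =
        CechH1.mk f U ⟨(z : CechOneCochain (structureSheafAb X) U),
          (mem_cechOneCocycles_structureSheafAb_iff f U _).mp z.2⟩ := fun z => rfl
  have hinj : Function.Injective φ := by
    rw [injective_iff_map_eq_zero]
    intro x hx
    obtain ⟨z, rfl⟩ := CechHOne.mk_surjective (structureSheafAb X) U x
    rw [hφ, CechH1.mk_eq_zero_iff] at hx
    rw [CechHOne.mk_eq_zero_iff]
    exact (mem_cechOneCoboundaries_structureSheafAb_iff f U _).mpr hx
  have hsurj : Function.Surjective φ := by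
    intro y
    obtain ⟨w, rfl⟩ := CechH1.mk_surjective f U y
    exact ⟨CechHOne.mk (structureSheafAb X) U ⟨(w : CechC1 f U), (mem_cechOneCocycles_structureSheafAb_iff f U _).mpr w.2⟩,
      hφ _⟩
  exact ⟨AddEquiv.ofBijective φ ⟨hinj, hsurj⟩, hφ⟩

/-- **Refinement is the same in both models**: the model isomorphisms intertwine ★ `Motives.CechHOne.refine` and ★
`Morphisms.cechRefineH1` (both are `c ↦ c_{τj, τj'}|`). [cite: Hartshorne1977, III Ex. 4.4 (a) (p. 224)] -/
theorem addEquiv_refine_eq {ι' : Type u} (V : ι' → X.Opens) (τ : ι' → ι) (hτ : ∀ j, V j ≤ U (τ j))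
    (eU : CechHOne (structureSheafAb X) U ≃+ CechH1 f U)
    (heU : ∀ z : cechOneCocycles (structureSheafAb X) U, eU (CechHOne.mk (structureSheafAb X) U z) =
      CechH1.mk f U ⟨(z : CechOneCochain (structureSheafAb X) U), (mem_cechOneCocycles_structureSheafAb_iff f U _).mp z.2⟩)
    (eV : CechHOne (structureSheafAb X) V ≃+ CechH1 f V)
    (heV : ∀ z : cechOneCocycles (structureSheafAb X) V, eV (CechHOne.mk (structureSheafAb X) V z) =
      CechH1.mk f V ⟨(z : CechOneCochain (structureSheafAb X) V), (mem_cechOneCocycles_structureSheafAb_iff f V _).mp z.2⟩)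
    (x : CechHOne (structureSheafAb X) U) :
    eV (CechHOne.refine (structureSheafAb X) U V τ hτ x) = cechRefineH1 f U V τ hτ (eU x) := by
  obtain ⟨z, rfl⟩ := CechHOne.mk_surjective (structureSheafAb X) U x
  rw [CechHOne.refine_mk, heV, heU, cechRefineH1_mk]
  rfl

/-- **Sectionwise-scalar endomorphisms act as scalars in both models**: if `μ : (𝒪_X)_{Ab} → (𝒪_X)_{Ab}` acts on every `Γ(X, V)` as
multiplication by `a ∈ A`, then the model isomorphism sends `Ȟ¹(𝔘, μ) x` to `a • (e x)`. [cite: Hartshorne1977, III Lemma 4.4 (p. 221)] -/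
theorem addEquiv_map_eq_smul (e : CechHOne (structureSheafAb X) U ≃+ CechH1 f U)
    (he : ∀ z : cechOneCocycles (structureSheafAb X) U, e (CechHOne.mk (structureSheafAb X) U z) =
      CechH1.mk f U ⟨(z : CechOneCochain (structureSheafAb X) U), (mem_cechOneCocycles_structureSheafAb_iff f U _).mp z.2⟩)
    (a : A) (μ : structureSheafAb X ⟶ structureSheafAb X)
    (hμ : ∀ (V : X.Opens) (x : Sections f V), (μ.hom.app (op V)).hom x = algebraMap A (Sections f V) a * x)
    (x : CechHOne (structureSheafAb X) U) :
    e (CechHOne.map μ U x) = a • e x := by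
  obtain ⟨z, rfl⟩ := CechHOne.mk_surjective (structureSheafAb X) U x
  rw [CechHOne.map_mk, he, he, ← map_smul]
  congr 1
  apply Subtype.ext
  funext i j
  change (μ.hom.app (op (U i ⊓ U j))).hom ((z : CechOneCochain (structureSheafAb X) U) i j) = _
  exact (hμ (U i ⊓ U j) (show Sections f (U i ⊓ U j) from (z : CechOneCochain (structureSheafAb X) U) i j)).trans
    (Algebra.smul_def a (show Sections f (U i ⊓ U j) from (z : CechOneCochain (structureSheafAb X) U) i j)).symm

/-! ## §2 The injective comparison `Ȟ¹(𝔘, 𝒪_X) → H¹(X, 𝒪_X)` with scalars, for every cover -/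

/-- **`Ȟ¹(𝔘, 𝒪_X) ↪ H¹(X, 𝒪_X)` WITH SCALARS, for EVERY open cover `𝔘` of `X`** (indexed in `Type u`): there is an INJECTIVE additive
map `Φ : Morphisms.CechH1 f 𝔘 → structureSheafCohomology X 1` sending the class of a cocycle `z` to ★ `cechToH z` ([Hartshorne1977] III
Lemma 4.4: the natural map, injective by [GortzWedhorn2023] Cor. 21.81), such that for every endomorphism `μ` of the abelian structure
sheaf acting sectionwise as multiplication by `a ∈ A`, `Φ (a • t) = H¹(μ) (Φ t)` (naturality of ★ `cechHOneToH`).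
[cite: Hartshorne1977, III Lemma 4.4 (p. 221)] [cite: GortzWedhorn2023, Cor. 21.81 (p. 185)] -/
theorem exists_cechH1_to_structureSheafCohomology (hU : iSup U = ⊤) :
    ∃ Φ : CechH1 f U →+ structureSheafCohomology X 1,
      Function.Injective Φ ∧
      (∀ z : cechZ1 f U, Φ (CechH1.mk f U z) =
        cechToH (structureSheafAb X) U hU ⟨(z : CechC1 f U), (mem_cechOneCocycles_structureSheafAb_iff f U _).mpr z.2⟩) ∧
      ∀ (a : A) (μ : structureSheafAb X ⟶ structureSheafAb X),
        (∀ (V : X.Opens) (x : Sections f V), (μ.hom.app (op V)).hom x = algebraMap A (Sections f V) a * x) →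
        ∀ t : CechH1 f U, Φ (a • t) = Sheaf.H.map μ 1 (Φ t) := by
  obtain ⟨e, he⟩ := exists_addEquiv_cechHOne_cechH1 f U
  refine ⟨(cechHOneToH (structureSheafAb X) U hU).comp e.symm.toAddMonoidHom, ?_, ?_, ?_⟩
  · exact (cechHOneToH_injective (structureSheafAb X) U hU).comp e.symm.injective
  · intro z
    have hz : e (CechHOne.mk (structureSheafAb X) U ⟨(z : CechC1 f U),
        (mem_cechOneCocycles_structureSheafAb_iff f U _).mpr z.2⟩) = CechH1.mk f U z := by
      rw [he]
    change cechHOneToH (structureSheafAb X) U hU (e.symm (CechH1.mk f U z)) = _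
    rw [← hz, e.symm_apply_apply, cechHOneToH_mk]
  · intro a μ hμ t
    obtain ⟨x, rfl⟩ := e.surjective t
    change cechHOneToH (structureSheafAb X) U hU (e.symm (a • e x)) =
      Sheaf.H.map μ 1 (cechHOneToH (structureSheafAb X) U hU (e.symm (e x)))
    rw [← addEquiv_map_eq_smul f U e he a μ hμ x, e.symm_apply_apply, e.symm_apply_apply, map_cechHOneToH]

/-! ## §3 Affine covers: the comparison is an isomorphism -/

/-- An affine open cover sees the common refinement with ANY cover: `U i ≤ ⨆ (U i ∩ W x)`. [cite: GortzWedhorn2023, Def. 21.71 (p. 181)] -/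
theorem le_iSup_commonRefinement {κ : Type u} (W : κ → X.Opens) (hW : iSup W = ⊤) (i : ι) :
    U i ≤ ⨆ p : ι × κ, commonRefinement U W p := by
  intro x hx
  have hx' : x ∈ (iSup W : X.Opens) := by rw [hW]; trivial
  obtain ⟨j, hj⟩ := Opens.mem_iSup.mp hx'
  exact Opens.mem_iSup.mpr ⟨(i, j), ⟨hx, hj⟩⟩

include f in
/-- **Surjectivity for an AFFINE cover**: every class of `H¹(X, 𝒪_X)` is `cechHOneToH` of a Čech class on the affine cover `𝔘` — it is
a Čech class on SOME cover `𝔚` (★ `exists_cechHOneToH_eq`, [Hartshorne1977] III Ex. 4.4 (c)), the refinement `Ȟ¹(𝔘) → Ȟ¹(𝔘 ∩ 𝔚)` is onto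
for `𝔘` affine (★ `cechRefineH1_bijective_of_isAffineOpen`, [Hartshorne1977] III Thm. 4.5), and classes with the same refinement have the
same image (★ `cechHOneToH_eq_cechHOneToH_iff`).  (The `A`-structure `f` is used only through the `Morphisms.CechH1 f` model of the
refinement step.) [cite: Hartshorne1977, III Ex. 4.4 (c) and Thm. 4.5 (p. 222)] [cite: GortzWedhorn2023, Cor. 21.81 (p. 185)] -/
theorem cechHOneToH_structureSheafAb_surjective (hUaff : ∀ i, IsAffineOpen (U i)) (hU : iSup U = ⊤) :
    Function.Surjective (cechHOneToH (structureSheafAb X) U hU) := by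
  intro ξ
  obtain ⟨W, hW, y, hy⟩ := exists_cechHOneToH_eq (structureSheafAb X) ξ
  have hW' : iSup W = ⊤ := iSup_eq_top_of_forall_mem W hW
  -- the common refinement `Z = 𝔘 ∩ 𝔚` and the model isomorphisms on `U` and `Z`
  have hZ : iSup (commonRefinement U W) = ⊤ := iSup_commonRefinement U W hU hW'
  obtain ⟨eU, heU⟩ := exists_addEquiv_cechHOne_cechH1 f U
  obtain ⟨eZ, heZ⟩ := exists_addEquiv_cechHOne_cechH1 f (commonRefinement U W)
  -- refine `y` to `Z` and pull it back to `U` through the bijective refinement (affine `U`)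
  have hbij := cechRefineH1_bijective_of_isAffineOpen f U (commonRefinement U W) Prod.fst (fun _ => inf_le_left) hUaff
    (le_iSup_commonRefinement U W hW')
  obtain ⟨xU, hxU⟩ := hbij.2 (eZ (CechHOne.refine (structureSheafAb X) W (commonRefinement U W) Prod.snd
    (fun _ => inf_le_right) y))
  refine ⟨eU.symm xU, ?_⟩
  rw [← hy, cechHOneToH_eq_cechHOneToH_iff (structureSheafAb X) U W hU hW']
  apply eZ.injective
  rw [addEquiv_refine_eq f U (commonRefinement U W) Prod.fst (fun _ => inf_le_left) eU heU eZ heZ, eU.apply_symm_apply, hxU]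

/-- **`H¹(X, 𝒪_X) ≃+ Ȟ¹(𝔘, 𝒪_X)` WITH SCALARS, for ONE AFFINE open cover** (any index type in `Type u`; no separatedness needed): there is an
additive isomorphism `e : structureSheafCohomology X 1 ≃+ Morphisms.CechH1 f 𝔘`, inverse to the natural comparison on classes
(`e.symm [z] = cechToH z`), such that every endomorphism `μ` of the abelian structure sheaf acting sectionwise as multiplication by `a ∈ A`
satisfies **`e (H¹(μ) t) = a • e t`** — the S-c2 letter of the (Mc) N3′ tower (at `X = A′_κ → Spec κ`, `a = c̄`).
[cite: Hartshorne1977, III Thm. 4.5 (p. 222) and Lemma 4.4] [cite: GortzWedhorn2023, Cor. 21.81 (p. 185) and Thm. 22.9] [cite: StacksProject, Tag 01XD] -/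
theorem exists_addEquiv_structureSheafCohomology_cechH1 (hUaff : ∀ i, IsAffineOpen (U i)) (hU : iSup U = ⊤) :
    ∃ e : structureSheafCohomology X 1 ≃+ CechH1 f U,
      (∀ z : cechZ1 f U, e.symm (CechH1.mk f U z) =
        cechToH (structureSheafAb X) U hU ⟨(z : CechC1 f U), (mem_cechOneCocycles_structureSheafAb_iff f U _).mpr z.2⟩) ∧
      ∀ (a : A) (μ : structureSheafAb X ⟶ structureSheafAb X),
        (∀ (V : X.Opens) (x : Sections f V), (μ.hom.app (op V)).hom x = algebraMap A (Sections f V) a * x) →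
        ∀ t : structureSheafCohomology X 1, e (Sheaf.H.map μ 1 t) = a • e t := by
  obtain ⟨Φ, hinj, hmk, hsc⟩ := exists_cechH1_to_structureSheafCohomology f U hU
  -- `Φ` is onto: its range contains the range of `cechHOneToH`, which is everything for an affine cover
  have hsurj : Function.Surjective Φ := by
    intro ξ
    obtain ⟨x, rfl⟩ := cechHOneToH_structureSheafAb_surjective f U hUaff hU ξ
    obtain ⟨z, rfl⟩ := CechHOne.mk_surjective (structureSheafAb X) U x
    refine ⟨CechH1.mk f U ⟨(z : CechOneCochain (structureSheafAb X) U),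
      (mem_cechOneCocycles_structureSheafAb_iff f U _).mp z.2⟩, ?_⟩
    rw [hmk, cechHOneToH_mk]
  let e := (AddEquiv.ofBijective Φ ⟨hinj, hsurj⟩).symm
  refine ⟨e, fun z => ?_, fun a μ hμ t => ?_⟩
  · change (AddEquiv.ofBijective Φ ⟨hinj, hsurj⟩) (CechH1.mk f U z) = _
    rw [AddEquiv.ofBijective_apply, hmk]
  · obtain ⟨s, rfl⟩ := hsurj t
    have h1 : e (Φ s) = s := (AddEquiv.ofBijective Φ ⟨hinj, hsurj⟩).symm_apply_apply s
    have h2 : e (Φ (a • s)) = a • s := (AddEquiv.ofBijective Φ ⟨hinj, hsurj⟩).symm_apply_apply (a • s)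
    rw [← hsc a μ hμ s, h1, h2]

/-! ## §4 The scalar endomorphisms exist: multiplication by a global function on the abelian structure sheaf -/

/-- **Multiplication by a global function `s ∈ Γ(X, 𝒪_X)` is an endomorphism of the abelian structure sheaf**, acting on `Γ(X, W)` as
`y ↦ s|_W · y` — the `ν` / `μ` that the scalar clauses of §2–§3 (and of S-c1) quantify over, EXHIBITED. [cite: Hartshorne1977, III Lemma 4.4 (p. 221)] -/
theorem exists_structureSheafAb_hom_mul (s : Γ(X, ⊤)) :
    ∃ ν : structureSheafAb X ⟶ structureSheafAb X,
      ∀ (W : X.Opens) (y : Γ(X, W)), (ν.hom.app (op W)).hom y = X.presheaf.map (homOfLE (le_top : W ≤ ⊤)).op s * y := by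
  refine ⟨ObjectProperty.homMk
    { app := fun W => AddCommGrpCat.ofHom
        (AddMonoidHom.mulLeft (X.presheaf.map (homOfLE (le_top : W.unop ≤ ⊤)).op s : Γ(X, W.unop)))
      naturality := fun W W' i => ?_ }, fun W y => rfl⟩
  ext y
  have hres : ∀ z : Γ(X, W.unop), ((structureSheafAb X).obj.map i).hom z = X.presheaf.map i z := fun z => rfl
  have hy : ((structureSheafAb X).obj.map i ≫ AddCommGrpCat.ofHom
      (AddMonoidHom.mulLeft (X.presheaf.map (homOfLE (le_top : W'.unop ≤ ⊤)).op s : Γ(X, W'.unop)))).hom y =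
      X.presheaf.map (homOfLE (le_top : W'.unop ≤ ⊤)).op s * X.presheaf.map i (show Γ(X, W.unop) from y) := by
    rw [AddCommGrpCat.hom_comp, AddMonoidHom.coe_comp, Function.comp_apply, hres]
    rfl
  have hy' : (AddCommGrpCat.ofHom (AddMonoidHom.mulLeft (X.presheaf.map (homOfLE (le_top : W.unop ≤ ⊤)).op s : Γ(X, W.unop))) ≫
      (structureSheafAb X).obj.map i).hom y =
      X.presheaf.map i (X.presheaf.map (homOfLE (le_top : W.unop ≤ ⊤)).op s * (show Γ(X, W.unop) from y)) := by
    rw [AddCommGrpCat.hom_comp, AddMonoidHom.coe_comp, Function.comp_apply, ← hres]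
    rfl
  refine hy.trans (Eq.trans ?_ hy'.symm)
  rw [map_mul, ← CommRingCat.comp_apply, ← Functor.map_comp]
  congr 2

/-- **The `a •` endomorphism of `Ȟ¹` is realised on `H¹(X, 𝒪_X)`**: for `a ∈ A` there is an endomorphism `ν` of the abelian structure
sheaf with `ν_V(x) = a|_V · x` in the shape of the scalar clauses of `exists_cechH1_to_structureSheafCohomology` /
`exists_addEquiv_structureSheafCohomology_cechH1`. [cite: Hartshorne1977, III Lemma 4.4 (p. 221)] -/
theorem exists_structureSheafAb_hom_algebraMap (a : A) :
    ∃ ν : structureSheafAb X ⟶ structureSheafAb X,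
      ∀ (V : X.Opens) (x : Sections f V), (ν.hom.app (op V)).hom x = algebraMap A (Sections f V) a * x :=
  exists_structureSheafAb_hom_mul (X := X) (algebraMapΓ f a)

end Literature.AlgebraicGeometry.Motives

end
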